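import Summits.Ventures.YMGap.RobustBall.Defs
import Summits.Ventures.YMGap.RobustBall.TermPerturbation
import Summits.Ventures.YMGap.RobustBall.TorusRange
import Literature.MathematicalPhysics.QuantumFieldTheory.BalabanFormatDensity
import Literature.MathematicalPhysics.QuantumFieldTheory.BlockCellGeometry
import Literature.MathematicalPhysics.QuantumFieldTheory.QuasiLocalGaugePerturbationWilson
import HarnessLib

/-!
# YM3IR / Reindex — the SENDER's half of the A3 port lemma, file 1 of 2: cube sites, the seam, the re-indexing map (i), the diameter exchange rate (ii)

HONEST FRAMING (cell pub-ymgap, track Y4 / YM3-IR, seat ym3ir-theory-1; tree edition of the staged scratch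
`HOME/ym3ir/lean/Reindex-theory1.scratch.lean` v1.1 sha16 c762fb9eb6b4f98b — gens 20/73, 2026-08-24 — SPLIT IN TWO at the
gate's size lint (≤ 400 lines per file): this file = §1–§3, `YM3IR/ReindexPort.lean` = §4–§7 (link counts (iii), the
meeting shape, the receiver door's real-valued line, the per-site sum re-indexing (iv-Σ)); the scratch's two
joint-elaboration `example`s are removed, the generic lemmas `mem_polymers_one` / `torusNorm_sub_le_polymerDiam` are track
Y2's (`RobustBall/TermPerturbation.lean`, `RobustBall/TorusRange.lean`) BY NAME, every other `def`/`theorem` unchanged).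
This file contains NO conjecture name, NO `sorry`, NO axiom, and claims NO mass gap, NO continuum limit, NO part of
Bałaban's theorems and NO membership of any UV output in any ball: it is finite-torus geometry and bookkeeping about the
Literature carrier `QuasiLocalGaugePerturbation d L G c` (imported read-only, untouched).  It is the SENDER's half of the
D3 port lemma of `HOME/ym3ir/D3-POSITION-theory1.md` v1.0 (sha16 cc68f10f402280a7) §7(c) — option (St): Steiner currency
over the CORNER set at block scale `c`, rate per lattice unit; lead ruling R334 (A3 GO, G11): D3 = YES option (St)
ADOPTED, file placement `YM3IR/Reindex.lean`, theory-1's pen — as split with seat ym3ir-theory-2 at the A3 receiver-port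
desk (`HOME/ym3ir/A3-BRIEF-theory2.md` v0.8 ff56068d523c92c5; `P2-LAWLEVEL-NOTE-theory2.md` v0.7.7 §9 «D3 FOLD»).  The
RECEIVER's half (the domination doors (β)/(γ)/(δ), `steinerCard`; port file M4 `YM3IR/ReceiverWitness.lean`, owner
theory-2) is not imported or restated anywhere in the two files — the halves meet at HYPOTHESES; the joint (St) corollary
(check record `HOME/ym3ir/lean/D3PortJoint-monolith-theory2.check.lean` 9b1d917dd32e05aa §J, countersigned in
`HOME/ym3ir/D3PortJoint-COUNTERSIGN-theory1.md` b710666f3504753c) is filed once both halves are in the tree.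

* §1 `cubeSites c X` — the SITES of the cubes labelled by the corner set `X` — and the SEAM with the scale-`1` carrier of
  track Y2 (`RobustBall.Perturbation d L N = QuasiLocalGaugePerturbation d L (SU N) 1`):
  `polymerEdges 1 (cubeSites c X) = polymerEdges c X`, the same for plaquettes, hence the SAME small-field analyticity
  domains `smallFieldDomain ρ 1 r ε (cubeSites c X) = smallFieldDomain ρ c r ε X` ((E1) radius unchanged by re-indexing);
* §2 `reindex : QuasiLocalGaugePerturbation d L G c → QuasiLocalGaugePerturbation d L G 1`, activity `W_X` placed on
  `cubeSites c X` and `0` on every site set that is not a union of cubes; (i) `(reindex W).total = W.total`, hence the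
  same weight / partition function / perturbed measure / expectations (SAME torus law), and the same sup norms polymer by
  polymer; at `G = SU(N)` the image is an element of track Y2's carrier (`example`);
* §3 the diameter exchange rate: coordinatewise `|x' − x|_L ≤ |corner x' − corner x|_L + (c − 1)` (`1 ≤ c`), hence
  (ii-d) `polymerDiam (cubeSites c X) ≤ polymerDiam X + (c − 1)` for ANY site set — no range control, no connectivity, no
  support hypothesis — composing with any size `st ≥ polymerDiam + 1` on polymers (a HYPOTHESIS here; theory-2's
  `steinerCard` is one) to `polymerDiam (cubeSites c X) + 1 ≤ (st X − 1) + c`; and (ii-D-rc)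
  `W.IsRangeControlled → W_X ≢ 0 → polymerDiam (cubeSites c X) ≤ c·|X| + (c − 1)` from the Literature lemma
  `natAbs_valMinAbs_sub_le_of_blockCorner_near`.

NOT HERE / NOT CLAIMED: the load half (iv) ((St-real) ∧ (St-an) ⇒ `InBall κ_b ε₀ ε₁ (reindex W)`) is receiver-side; NO UV
output is shown to meet any per-corner bound inside track Y2's radii; the cell's label of record stands («Bałaban statements AS
PRINTED with locators; ceilings are bookkeeping, no mass-gap / continuum / Clay claim», R196).
-/

noncomputable section

open Finset MeasureTheory
open Literature.MathematicalPhysics.QuantumFieldTheory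
open Summit.Ventures.YMGap.RobustBall (polymerDiam Perturbation SUN mem_polymers_one torusNorm_sub_le_polymerDiam)

namespace Summit.Ventures.YMGap.YM3IR.Reindex

variable {d L N : ℕ} [NeZero L] {G : Type*} {c : ℕ}

/-! ## §1 Cube sites and the seam with the scale-`1` carrier -/

/-- The **sites of the cubes of `X`**: all torus sites whose side-`c` block corner is a label of `X`. [folklore] -/
def cubeSites (c : ℕ) (X : Finset (Site d L)) : Finset (Site d L) :=
  univ.filter fun x => blockCorner c x ∈ X

/-- Membership in `cubeSites`. [folklore] -/
@[simp] theorem mem_cubeSites_iff {X : Finset (Site d L)} {x : Site d L} :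
    x ∈ cubeSites c X ↔ blockCorner c x ∈ X := by
  simp [cubeSites]

/-- Every block corner is a block corner (membership form of `blockCorners = univ.image`). [folklore] -/
theorem blockCorner_mem_blockCorners (c : ℕ) (x : Site d L) : blockCorner c x ∈ blockCorners c := by
  unfold blockCorners
  exact mem_image_of_mem _ (mem_univ x)

/-- The corner labels of any site set form a polymer at scale `c`. [folklore] -/
theorem image_blockCorner_mem_polymers (c : ℕ) (Y : Finset (Site d L)) :
    Y.image (blockCorner c) ∈ polymers c :=
  mem_polymers_iff.2 (image_subset_iff.2 fun x _ => blockCorner_mem_blockCorners c x)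

/-- A corner set lies inside its own cubes. [folklore] -/
theorem subset_cubeSites {X : Finset (Site d L)} (hX : X ∈ polymers c) : X ⊆ cubeSites c X := by
  intro y hy
  obtain ⟨z, -, rfl⟩ := mem_image.1 (mem_polymers_iff.1 hX hy)
  rw [mem_cubeSites_iff, blockCorner_blockCorner]
  exact hy

/-- The corner labels of the cubes of a corner set `X` are `X`. [folklore] -/
theorem image_blockCorner_cubeSites {X : Finset (Site d L)} (hX : X ∈ polymers c) :
    (cubeSites c X).image (blockCorner c) = X := by
  refine Subset.antisymm (image_subset_iff.2 fun x hx => mem_cubeSites_iff.1 hx) fun y hy => ?_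
  obtain ⟨z, -, rfl⟩ := mem_image.1 (mem_polymers_iff.1 hX hy)
  exact mem_image.2 ⟨blockCorner c z, mem_cubeSites_iff.2 (by rwa [blockCorner_blockCorner]),
    blockCorner_blockCorner c z⟩

/-- `cubeSites c` is injective on polymers. [folklore] -/
theorem cubeSites_injOn : Set.InjOn (cubeSites (d := d) (L := L) c) ↑(polymers (d := d) (L := L) c) := by
  intro X hX X' hX' h
  have h1 := image_blockCorner_cubeSites (c := c) hX
  have h2 := image_blockCorner_cubeSites (c := c) hX'
  rw [← h1, ← h2, h]

/-- **SEAM (links)**: the scale-`1` links of the cube sites of `X` are the scale-`c` links of `X`. [folklore] -/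
@[simp] theorem polymerEdges_one_cubeSites (X : Finset (Site d L)) :
    polymerEdges 1 (cubeSites c X) = polymerEdges c X := by
  ext e
  simp

/-- **SEAM (plaquettes)**: the scale-`1` plaquettes of the cube sites of `X` are the scale-`c` plaquettes of `X`. [folklore] -/
@[simp] theorem polymerPlaquettes_one_cubeSites (X : Finset (Site d L)) :
    polymerPlaquettes 1 (cubeSites c X) = polymerPlaquettes c X := by
  ext p
  simp [polymerPlaquettes]

/-- **SEAM (analyticity domains)**: the small-field domain of `cubeSites c X` at scale `1` IS the small-field
domain of `X` at scale `c` (same plaquette conditions, same radius) — the uniform radius (E1) is untouched by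
re-indexing. [folklore] -/
theorem smallFieldDomain_one_cubeSites [Group G] (ρ : G →* Matrix (Fin N) (Fin N) ℂ) (r ε : ℝ)
    (X : Finset (Site d L)) :
    smallFieldDomain ρ 1 r ε (cubeSites c X) = smallFieldDomain ρ c r ε X := by
  simp only [smallFieldDomain, polymerPlaquettes_one_cubeSites]

/-! ## §2 The re-indexing map and (i) -/

section Reindex

variable [Group G] [MeasurableSpace G]

/-- **Re-indexing to scale `1`**: the activity `W_X` of a scale-`c` perturbation is placed on the site set
`cubeSites c X`; every site set that is not a union of side-`c` cubes gets activity `0`. [folklore] -/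
def reindex (W : QuasiLocalGaugePerturbation d L G c) : QuasiLocalGaugePerturbation d L G 1 where
  act Y := if cubeSites c (Y.image (blockCorner c)) = Y then W.act (Y.image (blockCorner c)) else 0
  dependsOn' Y := by
    split_ifs with hY
    · intro U V hUV
      exact W.dependsOn' _ fun e he => hUV e (by rw [← hY, polymerEdges_one_cubeSites]; exact he)
    · exact fun _ _ _ => rfl
  gaugeInvariant' Y := by
    split_ifs
    · exact W.gaugeInvariant' _
    · exact fun _ _ => rfl
  measurable' Y := by
    split_ifs
    · exact W.measurable' _
    · exact measurable_const
  bounded' Y := by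
    split_ifs
    · exact W.bounded' _
    · exact ⟨0, fun _ => by simp⟩

variable (W : QuasiLocalGaugePerturbation d L G c)

/-- On the cubes of a corner set the re-indexed activity is the original one. [folklore] -/
@[simp] theorem reindex_act_cubeSites {X : Finset (Site d L)} (hX : X ∈ polymers c) :
    (reindex W).act (cubeSites c X) = W.act X := by
  simp [reindex, image_blockCorner_cubeSites hX]

/-- Off the unions of cubes the re-indexed activity vanishes. [folklore] -/
theorem reindex_act_of_ne {Y : Finset (Site d L)} (hY : cubeSites c (Y.image (blockCorner c)) ≠ Y) :
    (reindex W).act Y = 0 := by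
  simp [reindex, hY]

/-- A site set carrying a (possibly) non-zero re-indexed activity is the cube set of a polymer. [folklore] -/
theorem mem_image_cubeSites_of_act_ne_zero {Y : Finset (Site d L)} (hY : (reindex W).act Y ≠ 0) :
    Y ∈ (polymers c).image (cubeSites c) := by
  by_cases h : cubeSites c (Y.image (blockCorner c)) = Y
  · exact mem_image.2 ⟨_, image_blockCorner_mem_polymers c Y, h⟩
  · exact absurd (reindex_act_of_ne W h) hY

/-- **(i) The total perturbation is unchanged by re-indexing**: `∑_{Y} (reindex W)_Y = ∑_{X} W_X`. [folklore] -/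
theorem total_reindex : (reindex W).total = W.total := by
  funext U
  unfold QuasiLocalGaugePerturbation.total
  have h1 : ∑ Y ∈ (polymers c).image (cubeSites c), (reindex W).act Y U =
      ∑ Y ∈ polymers 1, (reindex W).act Y U := by
    refine sum_subset (fun Y _ => mem_polymers_one Y) fun Y _ hY => ?_
    by_contra hne
    exact hY (mem_image_cubeSites_of_act_ne_zero W fun h => hne (by rw [h]; rfl))
  rw [← h1, sum_image fun X hX X' hX' h => cubeSites_injOn hX hX' h]
  exact sum_congr rfl fun X hX => by rw [reindex_act_cubeSites W hX]

/-- (i′) Sup norms are carried polymer by polymer. [folklore] -/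
@[simp] theorem supNorm_reindex_cubeSites {X : Finset (Site d L)} (hX : X ∈ polymers c) :
    (reindex W).supNorm (cubeSites c X) = W.supNorm X := by
  simp only [QuasiLocalGaugePerturbation.supNorm, reindex_act_cubeSites W hX]

/-- (i′) Off the unions of cubes the sup norm vanishes. [folklore] -/
theorem supNorm_reindex_of_ne {Y : Finset (Site d L)} (hY : cubeSites c (Y.image (blockCorner c)) ≠ Y) :
    (reindex W).supNorm Y = 0 := by
  simp [QuasiLocalGaugePerturbation.supNorm, reindex_act_of_ne W hY]

variable [TopologicalSpace G] [IsTopologicalGroup G] [CompactSpace G] [BorelSpace G]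
variable (ρ : G →* Matrix (Fin N) (Fin N) ℂ) (β : ℝ)

/-- (i) ⇒ the same un-normalised weight `e^{-βS - W} ∏ dU`. [folklore] -/
theorem weight_reindex : (reindex W).weight ρ β = W.weight ρ β := by
  unfold QuasiLocalGaugePerturbation.weight
  rw [total_reindex]

/-- (i) ⇒ the same partition function. [folklore] -/
theorem partitionFunction_reindex : (reindex W).partitionFunction ρ β = W.partitionFunction ρ β := by
  unfold QuasiLocalGaugePerturbation.partitionFunction
  rw [weight_reindex]

/-- **(i) ⇒ the same perturbed torus measure** `μ_{β, reindex W} = μ_{β, W}`. [folklore] -/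
theorem perturbedMeasure_reindex : (reindex W).perturbedMeasure ρ β = W.perturbedMeasure ρ β := by
  unfold QuasiLocalGaugePerturbation.perturbedMeasure
  rw [partitionFunction_reindex, weight_reindex]

/-- (i) ⇒ the same expectations `⟨F⟩_{β, reindex W} = ⟨F⟩_{β, W}`. [folklore] -/
theorem expectation_reindex {V : Type*} [NormedAddCommGroup V] [NormedSpace ℝ V] (F : GaugeConfig d L G → V) :
    (reindex W).expectation ρ β F = W.expectation ρ β F := by
  unfold QuasiLocalGaugePerturbation.expectation
  rw [perturbedMeasure_reindex]

end Reindex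

/-- The re-indexed `SU(N)` perturbation IS an element of track Y2's carrier `RobustBall.Perturbation d L N`. [folklore] -/
example (W : QuasiLocalGaugePerturbation d L (SUN N) c) : Perturbation d L N := reindex W

/-! ## §3 The diameter exchange rate: (ii-d) and (ii-D-rc) -/

/-- **Coordinatewise exchange rate**: two sites are within cyclic distance `(distance of their corners) + (c − 1)`
of each other — the in-cube offsets `xᵢ mod c ∈ [0, c − 1]` partially cancel (the twin of the Literature lemma
`natAbs_valMinAbs_sub_le_of_blockCorner_near`, in `valMinAbs` currency and with a general corner distance). [folklore] -/
theorem natAbs_valMinAbs_sub_le_corner_add (hc : 1 ≤ c) (x x' : Site d L) (i : Fin d) :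
    ((x' i - x i).valMinAbs).natAbs ≤
      ((blockCorner c x' i - blockCorner c x i).valMinAbs).natAbs + (c - 1) := by
  have hdec : x' i - x i = (blockCorner c x' i - blockCorner c x i) +
      ((((x' i).val % c : ℕ) : ZMod L) - (((x i).val % c : ℕ) : ZMod L)) := by
    rw [← apply_sub_blockCorner, ← apply_sub_blockCorner]; abel
  rw [hdec]
  refine (ZMod.natAbs_valMinAbs_add_le _ _).trans ((Int.natAbs_add_le _ _).trans (Nat.add_le_add_left ?_ _))
  have hr : (x i).val % c < c := Nat.mod_lt _ hc
  have hr' : (x' i).val % c < c := Nat.mod_lt _ hc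
  rw [← Int.cast_natCast, ← Int.cast_natCast ((x i).val % c), ← Int.cast_sub]
  refine (ZMod.natAbs_min_of_le_div_two L _ _ (ZMod.coe_valMinAbs _)
    (ZMod.natAbs_valMinAbs_le _)).trans ?_
  omega

/-- **Exchange rate in `torusNorm`**: `‖x' − x‖ ≤ ‖corner x' − corner x‖ + (c − 1)`. [folklore] -/
theorem torusNorm_sub_le_corner_add (hc : 1 ≤ c) (x x' : Site d L) :
    torusNorm (x' - x) ≤ torusNorm (blockCorner c x' - blockCorner c x) + (c - 1) := by
  refine Finset.sup_le fun i _ => ?_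
  rw [Pi.sub_apply]
  refine (natAbs_valMinAbs_sub_le_corner_add hc x x' i).trans (Nat.add_le_add_right ?_ _)
  simpa only [Pi.sub_apply] using natAbs_valMinAbs_le_torusNorm (blockCorner c x' - blockCorner c x) i

/-- **(ii-d) The diameter of the cubes of `X` exceeds the diameter of the corner set by at most `c − 1`** —
no range control, no connectivity, any site set `X`. [folklore] -/
theorem polymerDiam_cubeSites_le (hc : 1 ≤ c) (X : Finset (Site d L)) :
    polymerDiam (cubeSites c X) ≤ polymerDiam X + (c - 1) := by
  refine Finset.sup_le fun x hx => Finset.sup_le fun y hy => ?_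
  rw [mem_cubeSites_iff] at hx hy
  exact (torusNorm_sub_le_corner_add hc y x).trans (Nat.add_le_add_right (torusNorm_sub_le_polymerDiam hx hy) _)

/-- **(ii)(d) of the note, literal shape**: with theory-2's Steiner size `st = steinerCard X` entering only through
its proved property `polymerDiam X + 1 ≤ st` (SteinerCurrency-theory2.scratch `polymerDiam_add_one_le_steinerCard`),
`polymerDiam (cubeSites c X) + 1 ≤ (st − 1) + c`. [folklore] -/
theorem polymerDiam_cubeSites_add_one_le (hc : 1 ≤ c) (X : Finset (Site d L)) {st : ℕ}
    (hst : polymerDiam X + 1 ≤ st) : polymerDiam (cubeSites c X) + 1 ≤ (st - 1) + c := by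
  have h := polymerDiam_cubeSites_le hc X
  omega

/-- **(ii-D-rc) Under range control a charged polymer's cubes have diameter `≤ c·|X| + (c − 1)`** (the NO-branch
variant; the Literature lemma `natAbs_valMinAbs_sub_le_of_blockCorner_near` verbatim, corner set `X`). [folklore] -/
theorem polymerDiam_cubeSites_le_of_isRangeControlled [Group G] [MeasurableSpace G] (hc : 1 ≤ c)
    {W : QuasiLocalGaugePerturbation d L G c} (hW : W.IsRangeControlled) {X : Finset (Site d L)}
    (hX : X ∈ polymers c) (hne : ∃ U, W.act X U ≠ 0) :
    polymerDiam (cubeSites c X) ≤ c * X.card + (c - 1) := by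
  refine Finset.sup_le fun x hx => Finset.sup_le fun y hy => ?_
  rw [mem_cubeSites_iff] at hx hy
  have hnear := hW X hX hne (blockCorner c x) hx (blockCorner c y) hy
  refine Finset.sup_le fun i _ => ?_
  rw [Pi.sub_apply]
  exact natAbs_valMinAbs_sub_le_of_blockCorner_near hc y x i (hnear i)

end Summit.Ventures.YMGap.YM3IR.Reindex

end
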